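import Literature.NumberTheory.EllipticCurves.HeegnerPointsKolyvaginPrimaryProp82Proofs
import HarnessLib

/-!
# McCallum 1991, Lemma 5.3 with Prop. 2.2 — the twisted form used by the Cassels–Tate local term

`Proofs` file (theorems only: no definition, no named fact) in topic `NumberTheory/EllipticCurves`,
companion of `HeegnerPointsKolyvaginPrimaryProp82Proofs` (`lemma_5_3_descent_of_reciprocity`:
McCallum's Lemma 5.3 with the reciprocity law, *"`ord d_λ > p^a ⟹ p^{M-1-a} s_λ = 0`"* for
eigenclasses of the same sign, from `e([s, F], [d, σ]) = 0`).

In Kolyvagin's bound on the ORDER of `Ш(E/K)` (McCallum 1991 Thm. 5.4 / Cor. 5.6) the same local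
duality at a Kolyvagin prime `λ` is applied to the LOCAL TERM of the Cassels–Tate pairing
(Milne, *ADT* I Prop. 6.9, first case): `inv_λ((loc_λ b₁ - β_λ) ∪ β'_λ)` with `β'_λ` a local lift
of `loc_λ t` along `[m]`, `m = p^k`. Its vanishing gives `e(P'', [d, σ]) = 1` only for a point `P''`
with `p^k P'' = [t, F]` (the Frobenius value of `β'_λ`), not for `[t, F]` itself. This file proves
the correspondingly twisted Lemma 5.3:

* `KolyvaginEigenPow.pow_nsmul_eq_zero_of_pairing_eq_zero_twisted` — the pure algebra: in
  `T = ℤu ⊕ ℤw` (`ι u = u`, `ι w = -w`, `p` odd, `p^M T = 0`) with `e u w` of order `p^M`, if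
  `ι x = x`, `y₀ ∈ ℤw` with `p^a y₀ ≠ 0`, `p^k P = x` and `e P y₀ = 0`, then `p^{M-1-a-k} x = 0`;
* `lemma_5_3_descent_of_reciprocity_twisted` — McCallum's Lemma 5.3 with the twisted reciprocity
  input: `p^{M-1-a-k} s ∈ ker(H¹(K, E_{p^M}) → H¹(K_λ, E_{p^M}))`. The proof is the tree's proof of
  `lemma_5_3_descent_of_reciprocity` token for token except for its Step 9 (the algebra above).

No named fact is introduced; axioms are the standard three.

## References

* [McCallumLMS1991] W. G. McCallum, *Kolyvagin's work on Shafarevich–Tate groups*, LMS Lecture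
  Note Ser. 153 (1991), 295–316: §2 Prop. 2.2, §5 Lemma 5.3, Thm. 5.4 (held, PDF pp. 279, 283–286).
* [GrossLMS1991] B. H. Gross, *Kolyvagin's work on modular elliptic curves*, same volume:
  §§7–9, Props. 8.1, 8.2, 9.6 (held, PDF pp. 223–229).
* [MilneADT2006] J. S. Milne, *Arithmetic Duality Theorems*, 2nd ed. (2006), Ch. I §6, proof of
  Prop. 6.9.
-/

noncomputable section

open scoped Classical Pointwise
open WeierstrassCurve NumberField IsDedekindDomain Field WithZero
open Literature.NumberTheory.GaloisRepresentations

universe u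

namespace Literature.NumberTheory.EllipticCurves

/-! ## The twisted algebra -/

namespace KolyvaginEigenPow

variable {T : Type*} [AddCommGroup T] {p M : ℕ}

/-- **Twisted form of McCallum's Lemma 5.3 (pure algebra).** `T` killed by `p^M` (`p` odd), `ι`
additive with `ι u = u`, `ι w = -w`, `T = ℤu + ℤw`, `e` biadditive alternating with `e u w` of order
`p^M`; if `ι x = x`, `y₀ ∈ ℤw` with `p^a y₀ ≠ 0`, `p^k P = x`, `e P y₀ = 0` and `k + a + 1 ≤ M`, then
`p^{M-1-a-k} x = 0`: writing `P = β u + δ w`, `e(P, y₀) = e(β u, y₀)` (`e(w, w) = 0`), so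
`p^{M-1-a} β u = 0` (`pow_nsmul_eq_zero_of_pairing_eq_zero`), and `p^k δ w = x - p^k β u` is fixed
and negated by `ι`, hence `0`. [cite: McCallumLMS1991, §5 Lemma 5.3] -/
theorem pow_nsmul_eq_zero_of_pairing_eq_zero_twisted (hp : p.Prime) (hp2 : p ≠ 2)
    (hT : ∀ t : T, p ^ M • t = 0) {A : Type*} [AddCommGroup A] (e : T →+ T →+ A)
    (halt : ∀ x, e x x = 0) (ι : T →+ T) {u w x y₀ P : T}
    (hu : ι u = u) (hw : ι w = -w) (hιx : ι x = x)
    (hy₀ : y₀ ∈ AddSubgroup.zmultiples w) (hgen : ∀ z, ∃ β δ : ℤ, z = β • u + δ • w)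
    (hω : addOrderOf (e u w) = p ^ M) {a k : ℕ} (ha : p ^ a • y₀ ≠ 0) (hP : p ^ k • P = x)
    (he : e P y₀ = 0) (hka : k + a + 1 ≤ M) : p ^ (M - 1 - a - k) • x = 0 := by
  obtain ⟨β, δ, hPβδ⟩ := hgen P
  obtain ⟨γ, rfl⟩ := AddSubgroup.mem_zmultiples_iff.mp hy₀
  have he' : e (β • u) (γ • w) = 0 := by
    have h1 : e P (γ • w) = e (β • u) (γ • w) + e (δ • w) (γ • w) := by
      rw [hPβδ, map_add, AddMonoidHom.add_apply]
    have h2 : e (δ • w) (γ • w) = 0 := by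
      rw [pairing_zsmul_left, map_zsmul, halt, smul_zero, smul_zero]
    rw [he, h2, add_zero] at h1
    exact h1.symm
  have h3 : p ^ (M - 1 - a) • (β • u) = 0 :=
    pow_nsmul_eq_zero_of_pairing_eq_zero hp hT e (AddSubgroup.mem_zmultiples_iff.mpr ⟨β, rfl⟩)
      (AddSubgroup.mem_zmultiples_iff.mpr ⟨γ, rfl⟩) hω ha he'
  -- the `w`-component of `x = p^k P` vanishes (`p` odd)
  have hz : p ^ k • (δ • w) = 0 := by
    have hz1 : ι (p ^ k • (δ • w)) = -(p ^ k • (δ • w)) := by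
      rw [map_nsmul, map_zsmul, hw, smul_neg, smul_neg]
    have hz2 : ι (p ^ k • (δ • w)) = p ^ k • (δ • w) := by
      have h4 : p ^ k • (δ • w) = x - p ^ k • (β • u) := by
        rw [← hP, hPβδ, smul_add, add_sub_cancel_left]
      rw [h4, map_sub, hιx, map_nsmul, map_zsmul, hu]
    refine eq_zero_of_eigen_of_eigen_neg hp hp2 hT ι (ν := 1) (Or.inl rfl) ?_ ?_
    · rw [one_smul]; exact hz2
    · rw [one_smul]; exact hz1
  have hx' : x = p ^ k • (β • u) := by
    rw [← hP, hPβδ, smul_add, hz, add_zero]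
  rw [hx', smul_smul, show p ^ (M - 1 - a - k) * p ^ k = p ^ (M - 1 - a) by
    rw [← pow_add]; congr 1; omega, h3]

end KolyvaginEigenPow

/-! ## McCallum's Lemma 5.3 with Prop. 2.2, twisted -/

section Main

open KolyvaginReciprocity

variable {K : Type u} [Field K] [NumberField K] (W : WeierstrassCurve ℚ)

set_option maxHeartbeats 1600000 in
/-- **McCallum 1991, Lemma 5.3 with Prop. 2.2 — twisted form (a `p^k`-th root on the Selmer side).**
Same setting as the tree's `lemma_5_3_descent_of_reciprocity` (`E/ℚ` elliptic, `K` imaginary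
quadratic with conjugation `c`, `p` odd, `M ≥ 1`, `ℓ` a Kolyvagin prime of level `M`, `λ` good,
`e` biadditive alternating left-non-degenerate on `E_{p^M}`, `d` a `ν`-eigenclass with `p^a d` not
Selmer at `λ`, `s ∈ S_{p^M}(E/K)` a `ν`-eigenclass), but the reciprocity input is TWISTED by `p^k`
on the Selmer side: for every `𝔔 ∣ λ`, Frobenius `F` at `𝔔` fixing `E_{p^M}` and `σ ∈ I_𝔔` there is
`P''` with `p^k P'' = [s, F]` and `e(P'', [d, σ]) = 0` — the shape in which the Cassels–Tate local
term at `λ` delivers its vanishing (the second argument of Milne's first case is a LOCAL lift `β'` of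
`loc t` along `[m]`, `m = p^k`, not an eigenclass). **Then `p^{M-1-a-k} s_λ = 0`** (`k + a + 1 ≤ M`).
Proof: the tree's proof verbatim up to Step 9, where the algebra becomes: `[d, σ₁] = γ w₀`,
`P'' = β u₀ + δ w₀`, `e(P'', γ w₀) = e(β u₀, γ w₀)` (`e` alternating), so `p^{M-1-a} β u₀ = 0`
(`pow_nsmul_eq_zero_of_pairing_eq_zero`); and `[s, F] = p^k P'' = p^k β u₀` because its
`w₀`-component is a `(∓ν)`-eigenvector lying in `ℤ[s, F] + ℤu₀ ⊆ E^{ν}` (`p` odd).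
[cite: McCallumLMS1991, §5 Lemma 5.3 (with §2 Prop. 2.2)] [cite: GrossLMS1991, Prop. 8.2 (proof), (7.6), Prop. 9.6]
[cite: MilneADT2006, Ch. I §6, proof of Prop. 6.9 (first case)] -/
theorem lemma_5_3_descent_of_reciprocity_twisted [W.IsElliptic] (hK : IsImaginaryQuadratic K)
    {p : ℕ} (hp : p.Prime) (hp2 : p ≠ 2) {c : K ≃ₐ[ℚ] K} (hc : c ≠ 1)
    {N ℓ : ℕ} (hℓ : IsKolyvaginPrime N W K p ℓ) {M : ℕ} (hM : 1 ≤ M) {q : ℕ} (hq : q = p ^ M)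
    (hℓM : FrobEqFrobInfty W K q ℓ)
    (hgood : (W.baseChange K).HasGoodReductionAt hℓ.place)
    {A : Type*} [AddCommGroup A]
    (e : geomTorsion (W.baseChange K) (q : ℤ) →+
      geomTorsion (W.baseChange K) (q : ℤ) →+ A)
    (halt : ∀ x, e x x = 0) (hnd : ∀ x, (∀ y, e x y = 0) → x = 0)
    {ν : ℤ} (hν : ν = 1 ∨ ν = -1)
    {d : galH1Torsion (W.baseChange K) (q : ℤ)}
    (hd : conjAct W c (q : ℤ) d = ν • d) {a k : ℕ} (hka : k + a + 1 ≤ M)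
    (hdv : ((p : ℤ) ^ a) • d ∉
      selmerLocalKer (W.baseChange K) (hℓ.place.adicCompletion K) (q : ℤ))
    {s : galH1Torsion (W.baseChange K) (q : ℤ)}
    (hs : s ∈ selmerGroup (W.baseChange K) (q : ℤ))
    (hτs : conjAct W c (q : ℤ) s = ν • s)
    (hR : ∀ 𝔔 ∈ hℓ.place.primesAbove, ∀ F : absoluteGaloisGroup K, IsArithFrobAt (𝓞 K) F 𝔔 →
      F ∈ torsionFixing (W.baseChange K) (q : ℤ) →
      ∀ σ ∈ 𝔔.inertia (absoluteGaloisGroup K),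
      ∃ P'' : geomTorsion (W.baseChange K) (q : ℤ),
        p ^ k • P'' = h1Eval (W.baseChange K) (q : ℤ) s F ∧
        e P'' (h1Eval (W.baseChange K) (q : ℤ) d σ) = 0) :
    ((p : ℤ) ^ (M - 1 - a - k)) • s ∈
      (W.baseChange K).torsionLocalKer (hℓ.place.adicCompletion K) (q : ℤ) := by
  classical
  haveI : Fact p.Prime := ⟨hp⟩
  haveI : Algebra.IsQuadraticExtension ℚ K := ⟨hK.1⟩
  haveI : IsTotallyComplex K := hK.2
  set w := hℓ.place with hwdef
  have hℓprime : ℓ.Prime := hℓ.prime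
  have hq0 : q ≠ 0 := by rw [hq]; exact pow_ne_zero M hp.ne_zero
  have hqpos : 0 < q := Nat.pos_of_ne_zero hq0
  have hq0Z : (q : ℤ) ≠ 0 := by exact_mod_cast hq0
  -- ### Step 0: `p, q ∉ λ`, `λ` good, `v_λ(ℓ) = 1`, `#E_q = q²`, `q E_q = 0`
  have hpw' : (p : 𝓞 K) ∉ w.asIdeal :=
    not_natCast_mem_of_prime_ne hℓprime hp hℓ.2.2.2.1 w hℓ.mem_place
  have hqw' : (q : 𝓞 K) ∉ w.asIdeal := by
    rw [hq, Nat.cast_pow]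
    exact fun h ↦ hpw' (w.isPrime.mem_of_pow_mem M h)
  have hqw : (((q : ℕ) : ℤ) : 𝓞 K) ∉ w.asIdeal := by rwa [Int.cast_natCast]
  have hwbad : w ∉ (W.baseChange K).badPlaces (𝓞 K) := fun h ↦ h hgood
  have hπ : w.valuation K (ℓ : K) = exp (-1 : ℤ) := by
    have h1 : (ℓ : K) = algebraMap (𝓞 K) K (ℓ : 𝓞 K) := by simp
    rw [h1, HeightOneSpectrum.valuation_of_algebraMap]
    exact w.intValuation_singleton (by exact_mod_cast hℓprime.ne_zero) rfl
  have hTq : ∀ P : geomTorsion (W.baseChange K) q, q • P = 0 := fun P ↦ by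
    have := (mem_geomTorsion_iff (W.baseChange K) q _).mp P.2
    apply Subtype.ext
    rw [AddSubgroupClass.coe_nsmul, ← natCast_zsmul]
    exact this
  have hcardK : Nat.card (geomTorsion (W.baseChange K) q) = q ^ 2 :=
    card_torsionPoints_eq_sq_holds (W.baseChange K) (AlgebraicClosure K)
      (by exact_mod_cast hq0)
  -- ### Step 1: the Frobenius data of (3.2)
  obtain ⟨v, 𝔓₀, h, c₀, hℓv, h𝔓₀, hh, hc₀, hE, hKact⟩ := hℓM
  have hHi := index_range_absGaloisRestrict_eq_finrank ℚ K
  haveI hHn : ((absGaloisRestrict ℚ K).range).Normal :=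
    Subgroup.normal_of_index_eq_two (hHi.trans hK.1)
  -- the copy `e₀ : K → ℚ̄` of `K` inside `ℚ̄`; `γ ∈ res(Γ_K)` iff `γ` fixes it pointwise
  set e₀ : K →ₐ[ℚ] AlgebraicClosure ℚ :=
    (absClosureEquiv ℚ K).symm.toAlgHom.comp
      (IsScalarTower.toAlgHom ℚ K (AlgebraicClosure K)) with he₀
  have he₀x : ∀ x : K, e₀ x = (absClosureEquiv ℚ K).symm (algebraMap K (AlgebraicClosure K) x) :=
    fun _ ↦ rfl
  have hrange : ∀ γ : absoluteGaloisGroup ℚ,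
      γ ∈ Set.range (absGaloisRestrict ℚ K) ↔ ∀ x : K, γ • e₀ x = e₀ x := fun γ ↦ by
    rw [mem_range_absGaloisRestrict_iff]
    refine forall_congr' fun x ↦ ?_
    rw [absGaloisTransport_apply, he₀x]
    constructor
    · intro h1
      apply (absClosureEquiv ℚ K).injective
      rw [AlgEquiv.apply_symm_apply]
      exact h1
    · intro h1
      rw [h1, AlgEquiv.apply_symm_apply]
  have hc₀H : c₀ ∉ Set.range (absGaloisRestrict ℚ K) :=
    hc₀.not_mem_range_absGaloisRestrict (L := K) IsTotallyComplex.isComplex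
  have hhH : h ∉ (absGaloisRestrict ℚ K).range := by
    intro hmem
    have hmem' : h ∈ Set.range (absGaloisRestrict ℚ K) := hmem
    apply hc₀H
    rw [hrange]
    intro x
    rw [← hKact e₀ x]
    exact (hrange h).mp hmem' x
  -- ### Step 2: `ℓ` unramified; the prime `𝔔 ∣ λ` and the Frobenius `τ'` with `res τ' = h²`
  have hunr : Algebra.IsUnramifiedIn (𝓞 K) v.asIdeal :=
    isUnramifiedIn_of_span_natCast_isPrime hℓprime hℓ.2.2.2.2.1 hℓv
  have hIr := inertia_le_range_absGaloisRestrict_of_isUnramifiedIn (K := K) hunr h𝔓₀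
  obtain ⟨w', 𝔔, τ', hw'v, -, -, h𝔔w, h𝔔𝔓₀, hτ', hresτ'⟩ :=
    exists_place_inert_of_not_mem_range (F := ℚ) (M := K) (hK.1 ▸ Nat.prime_two) hHn
      (hHi.trans rfl) hunr h𝔓₀ hIr hh hhH
  have hℓw' : (ℓ : 𝓞 K) ∈ w'.asIdeal := by
    have h1 : (ℓ : 𝓞 ℚ) ∈ (w'.under (𝓞 ℚ)).asIdeal := by rw [hw'v]; exact hℓv
    rw [HeightOneSpectrum.under_asIdeal, Ideal.under_def, Ideal.mem_comap, map_natCast] at h1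
    exact h1
  have hw'w : w' = w := hℓ.mem_iff.mp hℓw'
  subst hw'w
  rw [hK.1] at hresτ'
  haveI : 𝔔.IsPrime := h𝔔w.1
  -- ### Step 3: the lift `T = e h e⁻¹` of `c`; `τ'` acts on `K̄` as `T²` and fixes `E_p`
  set T := (absGaloisTransport (K := ℚ) (L := K)) h with hTdef
  have hTne : T.restrictNormal K ≠ 1 := by
    intro h1
    apply hhH
    change h ∈ Set.range (absGaloisRestrict ℚ K)
    rw [mem_range_absGaloisRestrict_iff]
    intro x
    have hx := AlgEquiv.restrictNormal_commutes T K x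
    rw [h1, AlgEquiv.one_apply] at hx
    exact hx.symm
  have ht : IsLiftOfAut c T.toRingEquiv := by
    have hcard : Nat.card (K ≃ₐ[ℚ] K) = 2 := by rw [IsGalois.card_aut_eq_finrank, hK.1]
    obtain ⟨y, -, hy⟩ := (Nat.card_eq_two_iff' (1 : K ≃ₐ[ℚ] K)).mp hcard
    rw [hy c hc, ← hy _ hTne]
    exact RatClosure.isLiftOfAut_restrictNormal_absGaloisTransport h
  have hτ'T : ∀ y : AlgebraicClosure K, (τ' : absoluteGaloisGroup K) • y = T (T y) := fun y ↦ by
    rw [← absGaloisTransport_absGaloisRestrict (K := ℚ) τ' y, hresτ', map_pow, pow_two,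
      AlgEquiv.mul_apply]
  have hτ'fix : τ' ∈ torsionFixing (W.baseChange K) q := by
    rw [mem_torsionFixing_iff]
    intro Q
    obtain ⟨P, rfl⟩ := (RatClosure.torsionEquiv (K := K) W (q : ℤ)).surjective Q
    rw [← RatClosure.torsionEquiv_smul W q τ' P, hresτ', pow_two, mul_smul, hE, hE,
      ← mul_smul, ← pow_two, hc₀.sq_eq_one, one_smul]
  -- ### Step 4: `conj_T τ' = τ'` and `T_*[s, τ'] = ν [s, τ']`
  have hconjτ' : ht.conjGalCMH τ' = τ' := by
    refine AlgEquiv.ext fun y ↦ ?_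
    change ht.conjGal τ' y = _
    rw [ht.conjGal_apply]
    change T.symm ((τ' : absoluteGaloisGroup K) • (T y)) = (τ' : absoluteGaloisGroup K) • y
    rw [hτ'T, hτ'T, AlgEquiv.symm_apply_apply]
  have hs_eigen : ht.torsionMap W q (h1Eval (W.baseChange K) q s τ') =
      ν • h1Eval (W.baseChange K) q s τ' :=
    torsionMap_h1Eval_eq_of_conjAct_eq W ht q hτ'fix hconjτ' hτs
  -- ### Step 5: `T` and `T⁻¹` map `𝔔` into itself; conjugation by `T` preserves `I_𝔔`
  haveI : 𝔓₀.IsPrime := h𝔓₀.1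
  have hh𝔓₀ : h • 𝔓₀ = 𝔓₀ := MulAction.mem_stabilizer_iff.mp hh.mem_stabilizer
  have hTint : ∀ y : AlgebraicClosure K, IsIntegral (𝓞 K) y →
      IsIntegral (𝓞 K) (T y) ∧ IsIntegral (𝓞 K) (T.symm y) := fun y hy ↦ by
    have hyZ : IsIntegral ℤ y := isIntegral_trans (R := ℤ) (A := 𝓞 K) y hy
    exact ⟨(hyZ.map T.toRingEquiv.toRingHom.toIntAlgHom).tower_top,
      (hyZ.map T.symm.toRingEquiv.toRingHom.toIntAlgHom).tower_top⟩
  -- `T (ι x) = ι (h x)`, `T⁻¹ (ι x) = ι (h⁻¹ x)` on `\bar ℤ_ℚ`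
  have hTmap1 : ∀ (γ : absoluteGaloisGroup ℚ) (x : absIntegers (𝓞 ℚ) ℚ),
      (absGaloisTransport (K := ℚ) (L := K)) γ (absIntegersMap ℚ K x : AlgebraicClosure K) =
        absIntegersMap ℚ K (γ • x) := fun γ x ↦ by
    rw [coe_absIntegersMap, coe_absIntegersMap, absGaloisTransport_absClosureEmbedding,
      integralClosure.coe_smul]
  have hTmap : ∀ x : absIntegers (𝓞 ℚ) ℚ,
      T (absIntegersMap ℚ K x : AlgebraicClosure K) = absIntegersMap ℚ K (h • x) ∧
      T.symm (absIntegersMap ℚ K x : AlgebraicClosure K) = absIntegersMap ℚ K (h⁻¹ • x) := by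
    intro x
    refine ⟨hTmap1 h x, ?_⟩
    have h3 := hTmap1 h (h⁻¹ • x)
    rw [smul_inv_smul] at h3
    -- `h3 : T (ι (h⁻¹ x)) = ι x`
    rw [← h3, ← hTdef, AlgEquiv.symm_apply_apply]
  have hmem𝔔 : ∀ x : absIntegers (𝓞 ℚ) ℚ, absIntegersMap ℚ K x ∈ 𝔔 ↔ x ∈ 𝔓₀ := fun x ↦ by
    rw [← Ideal.mem_comap, h𝔔𝔓₀]
  have hT𝔔 : ∀ (y : absIntegers (𝓞 K) K), y ∈ 𝔔 →
      (⟨T y, (hTint y y.2).1⟩ : absIntegers (𝓞 K) K) ∈ 𝔔 ∧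
      (⟨T.symm y, (hTint y y.2).2⟩ : absIntegers (𝓞 K) K) ∈ 𝔔 := by
    intro y hy
    obtain ⟨x, rfl⟩ := absIntegersMap_surjective ℚ K y
    have hx : x ∈ 𝔓₀ := (hmem𝔔 x).mp hy
    constructor
    · have : (⟨T (absIntegersMap ℚ K x), (hTint _ (absIntegersMap ℚ K x).2).1⟩ :
          absIntegers (𝓞 K) K) = absIntegersMap ℚ K (h • x) := Subtype.ext (hTmap x).1
      rw [this, hmem𝔔, ← hh𝔓₀]
      exact Ideal.smul_mem_pointwise_smul_iff.mpr hx
    · have : (⟨T.symm (absIntegersMap ℚ K x), (hTint _ (absIntegersMap ℚ K x).2).2⟩ :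
          absIntegers (𝓞 K) K) = absIntegersMap ℚ K (h⁻¹ • x) := Subtype.ext (hTmap x).2
      rw [this, hmem𝔔, ← Ideal.mem_pointwise_smul_iff_inv_smul_mem, hh𝔓₀]
      exact hx
  have hTconj : ∀ {σ : absoluteGaloisGroup K}, σ ∈ 𝔔.inertia (absoluteGaloisGroup K) →
      (ht.conjGalCMH σ : absoluteGaloisGroup K) ∈ 𝔔.inertia (absoluteGaloisGroup K) := by
    intro σ hσ
    rw [Ideal.inertia, AddSubgroup.mem_inertia] at hσ ⊢
    intro b
    set b' : absIntegers (𝓞 K) K := ⟨T b, (hTint b b.2).1⟩ with hb'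
    have h1 : σ • b' - b' ∈ 𝔔 := hσ b'
    have h2 := (hT𝔔 _ h1).2
    have heq : (ht.conjGalCMH σ : absoluteGaloisGroup K) • b - b =
        ⟨T.symm ((σ • b' - b' : absIntegers (𝓞 K) K) : AlgebraicClosure K),
          (hTint _ (σ • b' - b').2).2⟩ := by
      apply Subtype.ext
      change (((ht.conjGalCMH σ : absoluteGaloisGroup K) • b - b : absIntegers (𝓞 K) K) :
          AlgebraicClosure K) =
        T.symm ((σ • b' - b' : absIntegers (𝓞 K) K) : AlgebraicClosure K)
      rw [AddSubgroupClass.coe_sub, AddSubgroupClass.coe_sub, integralClosure.coe_smul,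
        integralClosure.coe_smul, map_sub]
      change ht.conjGal σ b - b = T.symm (σ • T b) - T.symm (T b)
      rw [ht.conjGal_apply, AlgEquiv.symm_apply_apply]
      rfl
    rw [heq]
    exact h2
  -- ### Step 6: `T⁻¹` inverts `μ_p`; the root `z = ℓ^{1/p}`; `conj_T σ` acts on `z` as `σ⁻¹`
  have hTinv : ∀ ζ : AlgebraicClosure K, ζ ^ q = 1 → T.symm ζ = ζ⁻¹ := by
    intro ζ hζ
    obtain ⟨ζ₀, rfl⟩ := (absClosureEmbedding_bijective ℚ K).2 ζ
    have hζ₀ : ζ₀ ^ q = 1 := by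
      apply (absClosureEmbedding_bijective ℚ K).1
      rw [map_pow, hζ, map_one]
    have h1 : T (absClosureEmbedding ℚ K ζ₀) = (absClosureEmbedding ℚ K ζ₀)⁻¹ := by
      rw [hTdef, absGaloisTransport_absClosureEmbedding,
        smul_eq_inv_of_smul_torsion_pow_eq W hp hM hq hc₀ hE hζ₀, map_inv₀]
    have h2 : T (absClosureEmbedding ℚ K ζ₀)⁻¹ = absClosureEmbedding ℚ K ζ₀ := by
      rw [map_inv₀, h1, inv_inv]
    conv_lhs => rw [← h2]
    exact AlgEquiv.symm_apply_apply T _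
  obtain ⟨z, hz⟩ := IsAlgClosed.exists_pow_nat_eq (algebraMap K (AlgebraicClosure K) (ℓ : K)) hqpos
  have hz0 : z ≠ 0 := by
    intro h0
    rw [h0, zero_pow hq0, eq_comm, map_eq_zero] at hz
    exact hℓprime.ne_zero (by exact_mod_cast hz)
  have hIfix : 𝔔.inertia (absoluteGaloisGroup K) ≤ torsionFixing (W.baseChange K) q :=
    fun i hi ↦ (mem_torsionFixing_iff _ _).mpr fun P ↦
      (W.baseChange K).smul_geomTorsion_eq_of_mem_inertia hgood hqw h𝔔w hi P
  -- inertia fixes `μ_p`, hence `θ_z` is a character on `I_𝔔` and `σ⁻¹ z = θ_z(σ)⁻¹ z`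
  have hIμ : ∀ {σ : absoluteGaloisGroup K}, σ ∈ 𝔔.inertia (absoluteGaloisGroup K) →
      ∀ {ζ : AlgebraicClosure K}, ζ ^ q = 1 → σ • ζ = ζ := fun hσ _ hζ ↦
    InertiaTame.smul_eq_of_mem_inertia_of_pow_eq_one w hqpos hqw' h𝔔w hσ hζ
  have hℓfix : ∀ σ : absoluteGaloisGroup K,
      σ • algebraMap K (AlgebraicClosure K) (ℓ : K) = algebraMap K (AlgebraicClosure K) (ℓ : K) :=
    fun σ ↦ by rw [absoluteGaloisGroup.smul_def, AlgEquiv.commutes]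
  have hθp : ∀ σ : absoluteGaloisGroup K, (σ • z / z) ^ q = 1 := fun σ ↦
    InertiaTame.smul_div_pow_eq_one hz hz0 (hℓfix σ)
  have hinvz : ∀ {σ : absoluteGaloisGroup K}, σ ∈ 𝔔.inertia (absoluteGaloisGroup K) →
      σ⁻¹ • z = (σ • z / z)⁻¹ * z := by
    intro σ hσ
    have h1 := InertiaTame.mul_smul_div_eq hz0 (τ := σ⁻¹) (σ' := σ) (hIμ (inv_mem hσ) (hθp σ))
    rw [inv_mul_cancel, one_smul, div_self hz0] at h1
    -- `h1 : 1 = (σ⁻¹ • z / z) * (σ • z / z)`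
    have h2 : σ⁻¹ • z / z = (σ • z / z)⁻¹ := eq_inv_of_mul_eq_one_left h1.symm
    rw [← h2, div_mul_cancel₀ _ hz0]
  -- `conj_T σ • z = σ⁻¹ • z` for `σ ∈ I_𝔔` (conjugation law, `T⁻¹` inverting `μ_p`)
  have hTℓ : T.symm (algebraMap K (AlgebraicClosure K) (ℓ : K)) =
      algebraMap K (AlgebraicClosure K) (ℓ : K) := by
    rw [map_natCast, map_natCast]
  have hcz : ∀ {σ : absoluteGaloisGroup K}, σ ∈ 𝔔.inertia (absoluteGaloisGroup K) →
      (ht.conjGalCMH σ : absoluteGaloisGroup K) • z = σ⁻¹ • z := by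
    intro σ hσ
    have h1 := InertiaTame.ringEquiv_apply_apply_symm_root T.symm.toRingEquiv hz hz0 hTℓ
      (fun y ↦ σ • y) (fun ζ hζ y ↦ by rw [smul_mul', hIμ hσ hζ])
    -- `h1 : T⁻¹ (σ • T z) = T⁻¹ (σ • z / z) * z`
    rw [hinvz hσ, ← hTinv _ (hθp σ)]
    change ht.conjGal σ z = _
    rw [ht.conjGal_apply]
    exact h1
  -- ### Step 7: the tame homomorphism `a = [d, ·]|_{I_𝔔}`: non-zero, cyclic image, `(-ν)`-eigen
  set av : 𝔔.inertia (absoluteGaloisGroup K) → geomTorsion (W.baseChange K) q :=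
    fun σ ↦ h1Eval (W.baseChange K) q d σ with hav
  have hac : Continuous av := (continuous_h1Eval _ _ d).comp continuous_subtype_val
  have haa : ∀ σ τ, av (σ * τ) = av σ + av τ := fun σ τ ↦
    h1Eval_mul (W.baseChange K) q d (hIfix σ.2) τ
  -- (7.1)/(7.4): `p^a d` fails the Selmer condition at `λ`, so some `p^a [d, σ₀] ≠ 0`
  have hd0 : ∃ σ₀ : 𝔔.inertia (absoluteGaloisGroup K), ((p : ℤ) ^ a) • av σ₀ ≠ 0 := by
    by_contra hall
    push Not at hall
    apply hdv
    rw [← oneCocycleClass_reprCocycle (W.baseChange K) q (((p : ℤ) ^ a) • d)]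
    refine ((W.baseChange K).oneCocycleClass_mem_selmerLocalKer_iff hgood hqw h𝔔w
      (reprCocycle (W.baseChange K) q (((p : ℤ) ^ a) • d))).mpr fun τ hτ ↦ ?_
    have h1 := hall ⟨τ, hτ⟩
    change h1Eval (W.baseChange K) q (((p : ℤ) ^ a) • d) τ = 0
    rwa [h1Eval_zsmul _ _ _ _ (hIfix hτ)]
  -- cyclicity of `av(I_𝔔)` (tame factorization through `θ_z`): a generator `y₀ = av σ₁`
  haveI : Finite (geomTorsion (W.baseChange K) q) := Nat.finite_of_card_ne_zero (by
    rw [hcardK]; exact pow_ne_zero 2 hq0)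
  obtain ⟨σ₁, -, hgen⟩ :=
    InertiaTame.exists_forall_apply_eq_nsmul w hqpos hqw' hπ hz h𝔔w hTq av hac haa
  have hy₀a : p ^ a • av σ₁ ≠ 0 := by
    obtain ⟨σ₀, hσ₀⟩ := hd0
    intro h0
    apply hσ₀
    obtain ⟨k, hk⟩ := hgen σ₀
    rw [hk, smul_comm, ← Nat.cast_pow, natCast_zsmul, h0, smul_zero]
  -- `T_*[d, σ] = -ν [d, σ]` on `I_𝔔`
  have hνν : ν * ν = 1 := by rcases hν with rfl | rfl <;> norm_num
  have hd_eigen : ∀ σ : 𝔔.inertia (absoluteGaloisGroup K),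
      ht.torsionMap W q (av σ) = -(ν • av σ) := by
    intro σ
    have hσT : (σ : absoluteGaloisGroup K) ∈ torsionFixing (W.baseChange K) q := hIfix σ.2
    have h1 := ht.h1Eval_conjAct W q d hσT
    rw [hd, h1Eval_zsmul _ _ _ _ hσT] at h1
    have h2 : av ⟨ht.conjGalCMH σ, hTconj σ.2⟩ =
        av ⟨(σ : absoluteGaloisGroup K)⁻¹, inv_mem σ.2⟩ :=
      InertiaTame.apply_eq_apply_of_smul_root_eq w hqpos hqw' hπ hz h𝔔w hTq av hac haa
        (hcz σ.2)
    have h3 : av ⟨(σ : absoluteGaloisGroup K)⁻¹, inv_mem σ.2⟩ = -av σ :=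
      h1Eval_inv (W.baseChange K) q d hσT
    change ν • av σ = ht.torsionMap W q (av ⟨ht.conjGalCMH σ, hTconj σ.2⟩) at h1
    rw [h2, h3, map_neg] at h1
    rw [h1, neg_neg]
  -- ### Step 8: `E_q = E_q⁺ ⊕ E_q⁻` with both parts cyclic of order `q` (McCallum Lemma 5.3)
  set ι := ht.torsionMap W q with hιdef
  -- `T_*` is an involution on `E_q`: on `E(ℚ̄)[q]`, `T = h = c₀`
  set θq := RatClosure.torsionEquiv (K := K) W (q : ℤ) with hθq
  have hιθ : ∀ P : geomTorsion W q, ι (θq P) = θq (c₀ • P) := fun P ↦ by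
    rw [← hE, ← RatClosure.torsionEquiv_smul_of_lift W ht h (fun _ ↦ rfl) q P]
  have hιinv : ∀ Q, ι (ι Q) = Q := fun Q ↦ by
    obtain ⟨P, rfl⟩ := θq.surjective Q
    rw [hιθ, hιθ, ← mul_smul, ← pow_two, hc₀.sq_eq_one, one_smul]
  -- sign-eigenvectors of `c₀` on `E(ℚ̄)[p] ⊆ E(ℚ̄)[q]`, transported to `E(K̄)[q]`
  have hpq : p ∣ q := hq ▸ dvd_pow_self p (by omega)
  have hEp : ∀ P : geomTorsion W p, h • P = c₀ • P := fun P ↦ by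
    have hPq : ((q : ℕ) : ℤ) • (P : geomPoints W) = 0 := by
      obtain ⟨m, hm⟩ := hpq
      rw [hm, Nat.cast_mul, mul_comm, mul_smul, (mem_geomTorsion_iff W p _).mp P.2, smul_zero]
    have h1 := congrArg Subtype.val (hE ⟨P.1, (mem_geomTorsion_iff W q _).mpr hPq⟩)
    rw [AddSubgroup.torsionBy.coe_smul, AddSubgroup.torsionBy.coe_smul] at h1
    apply Subtype.ext
    rw [AddSubgroup.torsionBy.coe_smul, AddSubgroup.torsionBy.coe_smul]
    exact h1
  obtain ⟨⟨e₁, he₁0, he₁⟩, ⟨e₂, he₂0, he₂⟩⟩ :=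
    RatClosure.exists_eigenvectors W hc₀ (W.exists_weilPairing_holds p) hp2
  set θp := RatClosure.torsionEquiv (K := K) W (p : ℤ) with hθp
  have hinclmem : ∀ Q : geomTorsion (W.baseChange K) p,
      ((q : ℕ) : ℤ) • (Q : geomPoints (W.baseChange K)) = 0 := fun Q ↦ by
    obtain ⟨m, hm⟩ := hpq
    rw [hm, Nat.cast_mul, mul_comm, mul_smul, (mem_geomTorsion_iff _ p _).mp Q.2, smul_zero]
  set incl : geomTorsion (W.baseChange K) p → geomTorsion (W.baseChange K) q :=
    fun Q ↦ ⟨Q.1, (mem_geomTorsion_iff _ q _).mpr (hinclmem Q)⟩ with hincl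
  have hincl_inj : Function.Injective incl := fun Q Q' hQ ↦ Subtype.ext
    (congrArg (fun R : geomTorsion (W.baseChange K) (q : ℤ) ↦ (R : geomPoints (W.baseChange K)))
      hQ)
  have hincl0 : incl 0 = 0 := Subtype.ext rfl
  have hincl_neg : ∀ Q, incl (-Q) = -incl Q := fun Q ↦ Subtype.ext rfl
  have hincl_p : ∀ Q, p • incl Q = 0 := fun Q ↦ Subtype.ext (by
    rw [AddSubgroupClass.coe_nsmul, ZeroMemClass.coe_zero]
    change p • (Q : geomPoints (W.baseChange K)) = 0
    rw [← natCast_zsmul]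
    exact (mem_geomTorsion_iff _ p _).mp Q.2)
  have hιincl : ∀ Q, ι (incl Q) = incl (ht.torsionMap W p Q) := fun Q ↦ by
    apply Subtype.ext
    simp only [hincl, hιdef, IsLiftOfAut.coe_torsionMap]
  have hθpT : ∀ P : geomTorsion W p, ht.torsionMap W p (θp P) = θp (c₀ • P) := fun P ↦ by
    rw [← hEp, ← RatClosure.torsionEquiv_smul_of_lift W ht h (fun _ ↦ rfl) p P]
  set v₁ := incl (θp e₁) with hv₁def
  set v₂ := incl (θp e₂) with hv₂def
  have hv₁ : ι v₁ = v₁ := by rw [hv₁def, hιincl, hθpT, he₁]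
  have hv₂ : ι v₂ = -v₂ := by rw [hv₂def, hιincl, hθpT, he₂, map_neg, hincl_neg]
  have hv₁0 : v₁ ≠ 0 := fun h0 ↦ he₁0 (θp.injective (hincl_inj (by
    rw [map_zero, hincl0]; exact h0)))
  have hv₂0 : v₂ ≠ 0 := fun h0 ↦ he₂0 (θp.injective (hincl_inj (by
    rw [map_zero, hincl0]; exact h0)))
  have hcardKp : Nat.card (geomTorsion (W.baseChange K) p) = p ^ 2 :=
    card_torsionPoints_eq_sq_holds (W.baseChange K) (AlgebraicClosure K)
      (by exact_mod_cast hp.ne_zero)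
  have hcardp : Nat.card {x : geomTorsion (W.baseChange K) q // p • x = 0} = p ^ 2 := by
    refine Eq.trans (Nat.card_congr ?_) hcardKp
    exact
      { toFun := fun x ↦ ⟨x.1.1, (mem_geomTorsion_iff _ p _).mpr (by
          have h1 := congrArg Subtype.val x.2
          rw [AddSubgroupClass.coe_nsmul, ZeroMemClass.coe_zero, ← natCast_zsmul] at h1
          exact h1)⟩
        invFun := fun Q ↦ ⟨incl Q, hincl_p Q⟩
        left_inv := fun x ↦ Subtype.ext (Subtype.ext rfl)
        right_inv := fun Q ↦ Subtype.ext rfl }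
  have hcardT : Nat.card (geomTorsion (W.baseChange K) q) = p ^ (2 * M) := by
    rw [hcardK, hq, ← pow_mul, mul_comm]
  have hTp' : ∀ t : geomTorsion (W.baseChange K) q, p ^ M • t = 0 := fun t ↦ by
    rw [← hq]; exact hTq t
  obtain ⟨u₀, w₀, hιu₀, hιw₀, hPu, hQw, hgen2, hou, how⟩ :=
    KolyvaginEigenPow.exists_eigen_generators hp hp2 hTp' hcardT hcardp ι hιinv hv₁0
      (hincl_p _) hv₁ hv₂0 (hincl_p _) hv₂
  -- ### Step 9: reciprocity and McCallum's Lemma 5.3: `p^{M-1-a} [s, τ'] = 0`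
  set x := h1Eval (W.baseChange K) q s τ' with hxdef
  obtain ⟨P'', hP''x, hRx⟩ := hR 𝔔 h𝔔w τ' hτ' hτ'fix σ₁ σ₁.2
  have hdσ₁ := hd_eigen σ₁
  have hx0 : p ^ (M - 1 - a - k) • x = 0 := by
    rcases hν with rfl | rfl
    · rw [one_smul] at hs_eigen hdσ₁
      have hy : av σ₁ ∈ AddSubgroup.zmultiples w₀ := hQw _ hdσ₁
      have hω := KolyvaginEigenPow.addOrderOf_pairing_eq hp hM hTp' e halt hnd hgen2
        (KolyvaginEigenPow.pow_pred_nsmul_ne_zero hp hM hou)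
      exact KolyvaginEigenPow.pow_nsmul_eq_zero_of_pairing_eq_zero_twisted hp hp2 hTp' e halt ι
        hιu₀ hιw₀ hs_eigen hy hgen2 hω hy₀a hP''x hRx hka
    · rw [neg_one_zsmul] at hs_eigen hdσ₁
      rw [neg_neg] at hdσ₁
      have hy : av σ₁ ∈ AddSubgroup.zmultiples u₀ := hPu _ hdσ₁
      have hgen' : ∀ z, ∃ β δ : ℤ, z = β • w₀ + δ • u₀ := fun z ↦ by
        obtain ⟨β, δ, hz⟩ := hgen2 z
        exact ⟨δ, β, by rw [hz, add_comm]⟩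
      have hω := KolyvaginEigenPow.addOrderOf_pairing_eq hp hM hTp' e halt hnd hgen'
        (KolyvaginEigenPow.pow_pred_nsmul_ne_zero hp hM how)
      have hιu₀' : (-ι) w₀ = w₀ := by rw [AddMonoidHom.neg_apply, hιw₀, neg_neg]
      have hιw₀' : (-ι) u₀ = -u₀ := by rw [AddMonoidHom.neg_apply, hιu₀]
      have hιx' : (-ι) x = x := by rw [AddMonoidHom.neg_apply, hs_eigen, neg_neg]
      exact KolyvaginEigenPow.pow_nsmul_eq_zero_of_pairing_eq_zero_twisted hp hp2 hTp' e halt (-ι)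
        hιu₀' hιw₀' hιx' hy hgen' hω hy₀a hP''x hRx hka
  -- ### Step 10: the class `p^{M-1-a-k} s` and Gross's Prop. 9.6 at `λ`
  set s' := ((p : ℤ) ^ (M - 1 - a - k)) • s with hs'def
  have hs' : s' ∈ selmerGroup (W.baseChange K) q := (selmerGroup (W.baseChange K) q).zsmul_mem hs _
  have hxs' : h1Eval (W.baseChange K) q s' τ' = 0 := by
    rw [hs'def, h1Eval_zsmul _ _ _ _ hτ'fix, ← hxdef, ← Nat.cast_pow, natCast_zsmul, hx0]
  haveI : CharZero (w.adicCompletion K) :=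
    charZero_of_injective_algebraMap (algebraMap K (w.adicCompletion K)).injective
  obtain ⟨𝔐, h𝔐⟩ := w.localPrimesAbove_nonempty
  set 𝔓w := w.primeBelow (closureEmb (K := K) (w.adicCompletion K)) 𝔐 with h𝔓wdef
  have h𝔓w : 𝔓w ∈ w.primesAbove := HeightOneSpectrum.primeBelow_mem_primesAbove h𝔐
  obtain ⟨δ, -, hF⟩ :=
    HeightOneSpectrum.exists_isArithFrobAt_conj_of_mem_primesAbove_holds h𝔔w h𝔓w hτ'
  have hFT : δ * τ' * δ⁻¹ ∈ torsionFixing (W.baseChange K) q :=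
    (torsionFixing_normal (W.baseChange K) q).conj_mem _ hτ'fix δ
  have hsunr : s' ∈ unramifiedKer (geomTorsion (W.baseChange K) q) 𝔓w :=
    selmerLocalKer_le_unramifiedKer (HeightOneSpectrum.exists_mem_inertia_apply_eq_holds w)
      (W.baseChange K).smul_localPoints_eq_of_mem_inertia_holds hwbad hqw h𝔓w
      (((mem_selmerGroup_iff (W.baseChange K) q s').mp hs').1 w)
  have hcrit := mem_torsionLocalKer_iff_h1Eval_eq_zero (W.baseChange K) (q : ℤ) h𝔐 hF hFT
    (inertia_le_torsionFixing (W.baseChange K) hwbad hqw _ h𝔐)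
    (isOpen_torsionFixing (W.baseChange K) hq0Z)
    (torsionPointsMap_bijective (W.baseChange K) (w.adicCompletion K) hq0).2 hsunr
  change s' ∈ _
  rw [hcrit, h1Eval_conj (W.baseChange K) q s' δ hτ'fix, hxs', smul_zero]


end Main

end Literature.NumberTheory.EllipticCurves

end
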